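import Summits.ValiantsHypothesis.ValiantsHypothesis.Theorems.SymPencilPerFourInnerRankPureGramLineTools

/-!
# Route `SymPencil` — P1 steps (4)–(5) on the line `ν-Gram = c₀` (class `+++`): `4 + 8` block form, diagonal/off-diagonal interface
# (`--supports` stmt-ValiantsHypothesis-5674 `SdcSuperquadratic`; (8,8) column; rung currency only)

Generated by `pub/val-lit/lmr/p8g14-P1/genlean.py` from the exact certificate data
(`L_families.json`, `certchain_ppp.json`; blueprint `BLUEPRINT-Lean.md`).  Setting: a PURE weighted
family `Σ_r c_r t_r(u,y)² = per` (`hJ`, `hX`) whose `ν`-Gram table `⟨n_bk, n_b'k'⟩` is the all-ones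
complementary form `c₀` (`hN`); `z` a coefficient vector in the kernel of the Gram map of the 32
generators `n_bk = t((0,e_b),(e_k,0))`, `m_al = t((e_a,0),(0,e_l))` (`hz`).  Honest framing: lemmas
toward the kernel proof of P1 (pure per₄-designs need 12 squares; paper proof with exact certificates in
`pub/val-lit/lmr/p8g14-P1/`); the cells `(8,8,10)`, `(8,8,11)`, the window `27 ≤ sdc(per_4) ≤ 29`, the
crux `SdcSuperquadratic` and `VP ≠ VNP` are untouched. No definitions, no named facts. [folklore]
-/

noncomputable section

-- single-conjunct layout: Sub = Summit, duplicated namespace component intended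
set_option linter.dupNamespace false
set_option linter.unusedSimpArgs false

namespace Summit.ValiantsHypothesis.ValiantsHypothesis.Theorems.SymPencilPerFourInnerRankPureGramLineToolsB

open Matrix Finset Module
open Summit.ValiantsHypothesis.ValiantsHypothesis.Theorems.SymPencilPerFourInnerRankRows
open Summit.ValiantsHypothesis.ValiantsHypothesis.Theorems.SymPencilPerFourInnerRankTenFamily
open Summit.ValiantsHypothesis.ValiantsHypothesis.Theorems.SymPencilPerFourInnerRankPureGramCount
open Summit.ValiantsHypothesis.ValiantsHypothesis.Theorems.SymPencilPerFourInnerRankPureGramLineTools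

variable {K : Type*} [Field K] [CharZero K] {ι : Type*} [Fintype ι]

omit [CharZero K] in
/-- **`4 + 8` block form, diagonal/off-diagonal version** of
`…PureGramLineTools.false_of_kernel_functionals_4_8` (the identity block given as two families,
avoiding `if … then 1 else 0` in the interface). [folklore] -/
theorem false_of_kernel_functionals_4_8' [DecidableEq ι] (hι : Fintype.card ι ≤ 11) (c : ι → K)
    {J : Type*} [Fintype J] [DecidableEq J] (u : J → ι → K) (aL vL : Fin 4 → J → K)
    (aE vE : Fin 8 → J → K)
    (hkillL : ∀ z : J → K, (∀ j' : J, ∑ j, z j * ∑ r, c r * u j r * u j' r = 0) →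
      ∀ i, ∑ j, aL i j * z j = 0)
    (hkillE : ∀ z : J → K, (∀ j' : J, ∑ j, z j * ∑ r, c r * u j r * u j' r = 0) →
      ∀ i, ∑ j, aE i j * z j = 0)
    (hLE : ∀ i i', ∑ j, aL i j * vE i' j = 0)
    (hEEdiag : ∀ i, ∑ j, aE i j * vE i j = 1)
    (hEEoff : ∀ i i', i ≠ i' → ∑ j, aE i j * vE i' j = 0)
    (h00 : ∑ j, aL 0 j * vL 0 j = 1) (h01 : ∑ j, aL 0 j * vL 1 j = 0)
    (h02 : ∑ j, aL 0 j * vL 2 j = 0) (h03 : ∑ j, aL 0 j * vL 3 j = 0)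
    (h10 : ∑ j, aL 1 j * vL 0 j = 0) (h11 : ∑ j, aL 1 j * vL 1 j = 1)
    (h12 : ∑ j, aL 1 j * vL 2 j = 0) (h13 : ∑ j, aL 1 j * vL 3 j = 0)
    (hD : (∑ j, aL 2 j * vL 2 j) * (∑ j, aL 3 j * vL 3 j) -
      (∑ j, aL 2 j * vL 3 j) * (∑ j, aL 3 j * vL 2 j) ≠ 0) : False :=
  false_of_kernel_functionals_4_8 hι c u aL vL aE vE hkillL hkillE hLE
    (fun i i' => by
      by_cases h : i = i'
      · subst h; simp [hEEdiag i]
      · rw [if_neg h]; exact hEEoff i i' h)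
    h00 h01 h02 h03 h10 h11 h12 h13 hD

end Summit.ValiantsHypothesis.ValiantsHypothesis.Theorems.SymPencilPerFourInnerRankPureGramLineToolsB

end
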